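import Summits.CriticalPhenomena.PercolationContinuityZ3.Theorems.PercNearOneGluingNoHeavyLowerTailKnQuestion8CoefficientwiseOffCluster
import HarnessLib

/-!
# Red-reached positivity on cylinder events: the `SET-RR₀` conjecture for bridges, trees and stars (prim-lf-2 gen 28)

Support file (`--supports stmt-CriticalPhenomena-4575`, closed), prover `prim-lf-2` (gen 28).  No definitions, no named facts, no sorries;
standard axioms.  Memo `prim-lf-2/CW-RR0-gen28.md` §1–2.

Setting (as in the other `Coefficientwise*` files).  A finite multigraph with edge set `ι` and end-point map `ends : ι → Sym2 V`; a colouring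
is `s : Finset ι` (red edges, `sᶜ` blue); `C_x(s) = openCluster (ends '' s) x` is the red cluster of `x`, `C_x(sᶜ)` the blue one; `f, g`
monotone set functions.  The red-reached atom of the programme (gen 27, memo `CW-NEGATIVE-gen27.md` §4) is
  `RR₀(G, v) : 0 ≤ Σ_{s : v ∈ C_x(s)} (f(C_x s) − f(C_x sᶜ))·(g(C_x s) − g(C_x sᶜ))`,
and gen 28 found (exact census, 0 negatives among ≈ 13 000 kernels, all graphs on 5 vertices and random ones on ≤ 7) that the same holds with
`{v ∈ C_x(s)}` replaced by `{S ⊆ C_x(s)}` for every vertex SET `S` (`SET-RR₀`; principal-filter weights), while union events `{C_x(s) ∩ S ≠ ∅}`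
fail already on the star `x–a, x–b`.  This file proves the cylinder case, which covers every `(G, x, S)` in which `{S ⊆ C_x(s)}` is the event
"a fixed edge set `R` is red" — all trees and forests, stars, and more generally every `S` joined to `x` only through bridges:

* `Coefficientwise.cylinder_twoColouring_nonneg` — for monotone `F, G` on the cube `Finset ι` and ANY `R`,
  `0 ≤ Σ_{s ⊇ R} (F s − F sᶜ)·(G s − G sᶜ)`  (the two-colouring Harris form restricted to a principal filter of the cube stays nonnegative;
  by complementation this is the cell `{t ∩ R = ∅}` of `twoColouring_cell_nonneg_of_le`, the free flip dominating pointwise);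
* `Coefficientwise.cluster_cylinder_nonneg` — the graph form `0 ≤ Σ_{s ⊇ R} Δf(s)·Δg(s)` for cluster functionals (red edges forced: the
  red cluster is computed in `G/R`, the blue one in `G − R`, and contraction dominates deletion);
* `Coefficientwise.setRR0_of_cylinder` — `SET-RR₀` for every `(x, S)` whose connection event is a cylinder:
  if `S ⊆ C_x(s) ↔ R ⊆ s` for all `s`, then `0 ≤ Σ_{s : S ⊆ C_x(s)} Δf·Δg`.
[cite: KozmaNitzan2024, Questions 8–9 (§5.5 p. 36) (context: first rung of the coefficientwise programme for Question 8)]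
-/

namespace Summit.CriticalPhenomena.PercolationContinuityZ3.Theorems

open Finset Literature.Probability.Percolation

namespace Coefficientwise

variable {ι : Type*} [Fintype ι] [DecidableEq ι]

/-- **Two-colouring Harris on a principal filter of the cube.**  For monotone `F, G : Finset ι → ℝ` and any `R : Finset ι`,
`0 ≤ Σ_{s ⊇ R} (F s − F sᶜ)(G s − G sᶜ)`.  Proof: `s ↦ sᶜ` carries the filter `{s ⊇ R}` onto the cell `{t | t ∩ R = ∅}` without changing the
summand, and on that cell `F t ≤ F (R ∪ t) = F ((R \ ∅) ∪ (t \ R))`, which is the hypothesis of `twoColouring_cell_nonneg_of_le`.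
[cite: KozmaNitzan2024, §5.5 (context only)] -/
theorem cylinder_twoColouring_nonneg (R : Finset ι) (F G : Finset ι → ℝ) (hF : Monotone F) (hG : Monotone G) :
    0 ≤ ∑ s ∈ univ.filter (fun s : Finset ι => R ⊆ s), (F s - F sᶜ) * (G s - G sᶜ) := by
  -- reindex by complementation onto the cell `{t | t ∩ R = ∅}`
  have hre : ∑ s ∈ univ.filter (fun s : Finset ι => R ⊆ s), (F s - F sᶜ) * (G s - G sᶜ) =
      ∑ t ∈ univ.filter (fun t : Finset ι => t ∩ R = ∅), (F t - F tᶜ) * (G t - G tᶜ) := by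
    refine Finset.sum_bij' (fun s _ => sᶜ) (fun t _ => tᶜ) ?_ ?_ ?_ ?_ ?_
    · intro s hs
      simp only [Finset.mem_filter, Finset.mem_univ, true_and] at hs ⊢
      ext i
      simp only [Finset.mem_inter, Finset.mem_compl, Finset.notMem_empty, iff_false, not_and]
      exact fun hi hiR => hi (hs hiR)
    · intro t ht
      simp only [Finset.mem_filter, Finset.mem_univ, true_and] at ht ⊢
      intro i hiR
      rw [Finset.mem_compl]
      intro hit
      have : i ∈ t ∩ R := Finset.mem_inter.mpr ⟨hit, hiR⟩
      rw [ht] at this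
      exact Finset.notMem_empty i this
    · intro s _; exact compl_compl s
    · intro t _; exact compl_compl t
    · intro s _
      simp only [compl_compl]
      ring
  rw [hre]
  refine twoColouring_cell_nonneg_of_le R ∅ (Finset.empty_subset R) F G hF hG ?_ ?_
  · intro t _
    exact hF (by
      intro i hi
      simp only [Finset.sdiff_empty, Finset.mem_union, Finset.mem_sdiff]
      by_cases hiR : i ∈ R
      · exact Or.inl hiR
      · exact Or.inr ⟨hi, hiR⟩)
  · intro t _
    exact hG (by
      intro i hi
      simp only [Finset.sdiff_empty, Finset.mem_union, Finset.mem_sdiff]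
      by_cases hiR : i ∈ R
      · exact Or.inl hiR
      · exact Or.inr ⟨hi, hiR⟩)

variable {V : Type*}

open Classical in
/-- **Forced red edges: contraction dominates deletion.**  For a finite multigraph `ends : ι → Sym2 V`, a root `x`, monotone `f, g : Set V → ℝ`
and any edge set `R`, `0 ≤ Σ_{s ⊇ R} (f(C_x s) − f(C_x sᶜ))·(g(C_x s) − g(C_x sᶜ))`: with the edges of `R` red, the red cluster of `x` is its
cluster in `G/R` and the blue one its cluster in `G − R` (memo CW-RR0-gen28 §2, 'red advantages are compatible with red conditioning').
[cite: KozmaNitzan2024, Questions 8–9 (§5.5 p. 36) (context)] -/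
theorem cluster_cylinder_nonneg (ends : ι → Sym2 V) (x : V) (R : Finset ι) (f g : Set V → ℝ)
    (hf : Monotone f) (hg : Monotone g) :
    0 ≤ ∑ s ∈ univ.filter (fun s : Finset ι => R ⊆ s),
      (f (openCluster (ends '' (↑s : Set ι)) x) - f (openCluster (ends '' (↑(sᶜ) : Set ι)) x)) *
        (g (openCluster (ends '' (↑s : Set ι)) x) - g (openCluster (ends '' (↑(sᶜ) : Set ι)) x)) := by
  have hFm : Monotone (fun s : Finset ι => f (openCluster (ends '' (↑s : Set ι)) x)) :=
    fun s t hst => hf (openCluster_image_mono ends hst x)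
  have hGm : Monotone (fun s : Finset ι => g (openCluster (ends '' (↑s : Set ι)) x)) :=
    fun s t hst => hg (openCluster_image_mono ends hst x)
  exact cylinder_twoColouring_nonneg R _ _ hFm hGm

open Classical in
/-- **`SET-RR₀` on cylinder events (trees, stars, bridges).**  If, for a vertex set `S`, the event "`S` lies in the red cluster of `x`" coincides
with "the edges of `R` are red" (e.g. `G` a tree and `R` the union of the `x–u` paths, `u ∈ S`; or every `x–S` path of `G` uses only bridges),
then `0 ≤ Σ_{s : S ⊆ C_x(s)} (f(C_x s) − f(C_x sᶜ))·(g(C_x s) − g(C_x sᶜ))` — prim-lf-2's conjecture `SET-RR₀` (gen 28; `S = {v}` is the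
red-reached atom `RR₀` of gen 27) in the cylinder case.  [cite: KozmaNitzan2024, Questions 8–9 (§5.5 p. 36) (context)] -/
theorem setRR0_of_cylinder (ends : ι → Sym2 V) (x : V) (S : Set V) (R : Finset ι)
    (hcyl : ∀ s : Finset ι, (∀ a ∈ S, a ∈ openCluster (ends '' (↑s : Set ι)) x) ↔ R ⊆ s)
    (f g : Set V → ℝ) (hf : Monotone f) (hg : Monotone g) :
    0 ≤ ∑ s ∈ univ.filter (fun s : Finset ι => ∀ a ∈ S, a ∈ openCluster (ends '' (↑s : Set ι)) x),
      (f (openCluster (ends '' (↑s : Set ι)) x) - f (openCluster (ends '' (↑(sᶜ) : Set ι)) x)) *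
        (g (openCluster (ends '' (↑s : Set ι)) x) - g (openCluster (ends '' (↑(sᶜ) : Set ι)) x)) := by
  have hfilter : univ.filter (fun s : Finset ι => ∀ a ∈ S, a ∈ openCluster (ends '' (↑s : Set ι)) x) =
      univ.filter (fun s : Finset ι => R ⊆ s) := by
    ext s
    simp only [Finset.mem_filter, Finset.mem_univ, true_and]
    exact hcyl s
  rw [hfilter]
  exact cluster_cylinder_nonneg ends x R f g hf hg

end Coefficientwise

end Summit.CriticalPhenomena.PercolationContinuityZ3.Theorems
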